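import Summits.AtomisticToContinuum.Crystallization.Theorems.SquareWellLayerCakeStackingFaultSparsityFarPasteLattice
import Summits.AtomisticToContinuum.Crystallization.Theorems.PhononSlackCertificatesAllBadGapFloor

/-!
# Crux `SummedShellPricing` (stmt-AtomisticToContinuum-17044, K1 of route `SpectralChargeLedger`),
# line `Sketch` (skeleton v3): stub `stub_calibratedFloor` — calibrated site energies are bounded
# below on `1/3`-separated sets

Stub `stub_calibratedFloor` of line Sketch v3 of the crux
`Summit.AtomisticToContinuum.Crystallization.Theses.SpectralChargeLedger.SummedShellPricing`
(item stmt-AtomisticToContinuum-17044): for every flux bound `G ≥ 0` there is `C₀ ≥ 0` such that on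
every `1/3`-separated `S ⊆ ℝ³`, for every pair flux `g` with `|g y z| ≤ G·(dist y z)⁻⁶` and every
`y ∈ S`,
`−C₀ ≤ ½ Σ'_{z ∈ S, z ≠ y} V_LJ(dist y z) + Σ'_{z ∈ S, z ≠ y} g y z`.
It feeds the composition `interiorLedgerAt_of_calibration` of the skeleton (the flat lower bound of
the calibrated site energy at the sites that are not deep-good).

Proof (pure separated-set bookkeeping, `C₀ = (1/12 + G) · 250 · 3⁶`).
* `Σ'_{z ∈ S, z ≠ y} (dist y z)⁻⁶ ≤ 250 · δ₀⁻⁶` on a `δ₀`-separated set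
  (`tsum_inv_pow_six_le_of_separated`: every partial sum is a shell sum `sum_inv_pow_six_le` of a
  finite separated configuration, exactly as in the tree's `summable_inv_pow_six_of_separated`).
* `V_LJ(r) = r⁻¹²/12 − r⁻⁶/6 ≥ −r⁻⁶/6` (tree: `PhononSlackCertificatesAllBadGapFloor.
  neg_inv_pow_six_le_lennardJones`), so the (summable, `summable_lennardJones_of_separated`)
  Lennard-Jones sum is `≥ −250·3⁶/6`.
* `|g y z| ≤ G (dist y z)⁻⁶` makes the flux family absolutely summable with
  `|Σ' g| ≤ G · 250 · 3⁶` (`tsum_of_norm_bounded`).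
All `[folklore]`; no new definitions.
-/

noncomputable section

namespace Summit.AtomisticToContinuum.Crystallization.Theorems.SummedShellPricingCalibratedFloor

open scoped BigOperators
open Literature.MathematicalPhysics.StatisticalMechanics
open Summit.AtomisticToContinuum.Crystallization.Theorems.SquareWellLayerCake.StackingFaultSparsity
open Summit.AtomisticToContinuum.Crystallization.Theorems.PhononSlackCertificatesAllBadGapFloor
  (neg_inv_pow_six_le_lennardJones)

/-- Over a `δ₀`-separated point set `S ⊆ ℝ³` (`δ₀ > 0`), every finite partial sum of
`z ↦ |z₀ - z|⁻⁶` (`z ∈ S`, `z ≠ z₀ ∈ S`) is at most `250 · δ₀⁻⁶`: it is a shell sum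
`sum_inv_pow_six_le` of a finite separated configuration. [folklore] -/
theorem sum_inv_pow_six_le_of_separated {S : Set (EuclideanSpace ℝ (Fin 3))} {δ₀ : ℝ}
    (hδ₀ : 0 < δ₀) (hS : ∀ z ∈ S, ∀ z' ∈ S, z ≠ z' → δ₀ ≤ dist z z')
    {z₀ : EuclideanSpace ℝ (Fin 3)} (hz₀ : z₀ ∈ S) (u : Finset {z // z ∈ S ∧ z ≠ z₀}) :
    ∑ z ∈ u, (dist z₀ z.1)⁻¹ ^ 6 ≤ 250 * δ₀⁻¹ ^ 6 := by
  -- adapted from `SquareWellLayerCake.StackingFaultSparsity.summable_inv_pow_six_of_separated`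
  classical
  have hinj : Set.InjOn (fun z : {z // z ∈ S ∧ z ≠ z₀} => z.1) ↑u := fun z _ z' _ h =>
    Subtype.ext h
  obtain ⟨F, hF⟩ : ∃ F : Finset (EuclideanSpace ℝ (Fin 3)),
      F = u.image (fun z : {z // z ∈ S ∧ z ≠ z₀} => z.1) := ⟨_, rfl⟩
  have h1 : ∑ z ∈ u, (dist z₀ z.1)⁻¹ ^ 6 = ∑ w ∈ F, (dist z₀ w)⁻¹ ^ 6 := by
    rw [hF, Finset.sum_image hinj]
  have hFmem : ∀ w ∈ F, w ∈ S ∧ w ≠ z₀ := by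
    intro w hw
    rw [hF] at hw
    obtain ⟨z, -, rfl⟩ := Finset.mem_image.1 hw
    exact z.2
  have hz₀F : z₀ ∉ F := fun h0 => (hFmem z₀ h0).2 rfl
  have hTS : ∀ c ∈ insert z₀ F, c ∈ S := fun c hc => by
    rcases Finset.mem_insert.1 hc with rfl | hc
    exacts [hz₀, (hFmem c hc).1]
  rw [h1, ← Finset.erase_insert hz₀F]
  obtain ⟨N, y, i, hyi, -, -, hsep', hsum⟩ := exists_fin_enum_onto (insert z₀ F)
    (Finset.mem_insert_self z₀ F) (fun c hc d hd hcd => hS c (hTS c hc) d (hTS d hd) hcd)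
  rw [hsum (fun w => (dist z₀ w)⁻¹ ^ 6), ← hyi]
  exact sum_inv_pow_six_le y hδ₀ hsep' i

/-- Over a `δ₀`-separated point set `S ⊆ ℝ³` (`δ₀ > 0`), the sixth-power site sum
`Σ'_{z ∈ S, z ≠ z₀} |z₀ - z|⁻⁶` is at most `250 · δ₀⁻⁶` (the `tsum` form of
`summable_inv_pow_six_of_separated`). [folklore] -/
theorem tsum_inv_pow_six_le_of_separated {S : Set (EuclideanSpace ℝ (Fin 3))} {δ₀ : ℝ}
    (hδ₀ : 0 < δ₀) (hS : ∀ z ∈ S, ∀ z' ∈ S, z ≠ z' → δ₀ ≤ dist z z')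
    {z₀ : EuclideanSpace ℝ (Fin 3)} (hz₀ : z₀ ∈ S) :
    ∑' z : {z // z ∈ S ∧ z ≠ z₀}, (dist z₀ z.1)⁻¹ ^ 6 ≤ 250 * δ₀⁻¹ ^ 6 :=
  (summable_inv_pow_six_of_separated hδ₀ hS hz₀).tsum_le_of_sum_le
    (sum_inv_pow_six_le_of_separated hδ₀ hS hz₀)

/-- **Stub 1c of line `Sketch` (v3) — CALIBRATED FLOOR.**  For every flux bound `G ≥ 0` there is
`C₀ ≥ 0` (namely `(1/12 + G) · 250 · 3⁶`) such that on every `1/3`-separated `S ⊆ ℝ³`, for every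
pair flux `g` with `|g y z| ≤ G·(dist y z)⁻⁶`, every calibrated site energy is at least `−C₀`:
`−C₀ ≤ ½ Σ'_{z ∈ S, z ≠ y} V_LJ(dist y z) + Σ'_{z ∈ S, z ≠ y} g y z`
(`V_LJ(r) ≥ −r⁻⁶/6`, `|g| ≤ G r⁻⁶`, `Σ'_{z ≠ y} (dist y z)⁻⁶ ≤ 250·3⁶`). [folklore] -/
theorem stub_calibratedFloor :
    ∀ G : ℝ, 0 ≤ G → ∃ C₀ : ℝ, 0 ≤ C₀ ∧
      ∀ S : Set (EuclideanSpace ℝ (Fin 3)), (∀ u ∈ S, ∀ v ∈ S, u ≠ v → (1 / 3 : ℝ) ≤ dist u v) →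
        ∀ g : EuclideanSpace ℝ (Fin 3) → EuclideanSpace ℝ (Fin 3) → ℝ,
          (∀ y z, |g y z| ≤ G * (dist y z)⁻¹ ^ 6) →
          ∀ y ∈ S, -C₀ ≤ 1 / 2 * (∑' z : {z // z ∈ S ∧ z ≠ y}, lennardJones (dist y z.1))
                        + ∑' z : {z // z ∈ S ∧ z ≠ y}, g y z.1 := by
  intro G hG
  set B : ℝ := 250 * (1 / 3 : ℝ)⁻¹ ^ 6 with hB
  have hB0 : 0 ≤ B := by positivity
  refine ⟨(1 / 12 + G) * B, by positivity, fun S hS g hg y hy => ?_⟩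
  have h3 : (0 : ℝ) < 1 / 3 := by norm_num
  have hV := summable_lennardJones_of_separated h3 hS hy
  have h6 := summable_inv_pow_six_of_separated h3 hS hy
  have h6le : ∑' z : {z // z ∈ S ∧ z ≠ y}, (dist y z.1)⁻¹ ^ 6 ≤ B :=
    tsum_inv_pow_six_le_of_separated h3 hS hy
  -- the Lennard-Jones sum is `≥ -B/6`
  have hVge : -(1 / 6 * B) ≤ ∑' z : {z // z ∈ S ∧ z ≠ y}, lennardJones (dist y z.1) := by
    have h1 : ∑' z : {z // z ∈ S ∧ z ≠ y}, -(1 / 6 * (dist y z.1)⁻¹ ^ 6) ≤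
        ∑' z : {z // z ∈ S ∧ z ≠ y}, lennardJones (dist y z.1) :=
      Summable.tsum_le_tsum (fun z => neg_inv_pow_six_le_lennardJones _)
        (h6.mul_left (1 / 6)).neg hV
    rw [tsum_neg, tsum_mul_left] at h1
    have h2 : 1 / 6 * ∑' z : {z // z ∈ S ∧ z ≠ y}, (dist y z.1)⁻¹ ^ 6 ≤ 1 / 6 * B :=
      mul_le_mul_of_nonneg_left h6le (by norm_num)
    exact (neg_le_neg h2).trans h1
  -- the flux sum is absolutely summable, `|Σ' g| ≤ G B`
  have hgabs : ∀ z : {z // z ∈ S ∧ z ≠ y}, ‖g y z.1‖ ≤ G * (dist y z.1)⁻¹ ^ 6 := fun z => by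
    rw [Real.norm_eq_abs]
    exact hg y z.1
  have hgge : -(G * B) ≤ ∑' z : {z // z ∈ S ∧ z ≠ y}, g y z.1 := by
    have h1 : ‖∑' z : {z // z ∈ S ∧ z ≠ y}, g y z.1‖ ≤
        G * ∑' z : {z // z ∈ S ∧ z ≠ y}, (dist y z.1)⁻¹ ^ 6 :=
      tsum_of_norm_bounded (h6.hasSum.mul_left G) hgabs
    rw [Real.norm_eq_abs] at h1
    exact (neg_le_neg (mul_le_mul_of_nonneg_left h6le hG)).trans (abs_le.1 h1).1
  -- combine
  have hC : -((1 / 12 + G) * B) = 1 / 2 * (-(1 / 6 * B)) + -(G * B) := by ring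
  rw [hC]
  exact add_le_add (mul_le_mul_of_nonneg_left hVge (by norm_num)) hgge

end Summit.AtomisticToContinuum.Crystallization.Theorems.SummedShellPricingCalibratedFloor

end
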